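import Summits.KontsevichZagierPeriods.KontsevichZagierPeriods.Theses.HurwitzMicroSectors
import Summits.KontsevichZagierPeriods.KontsevichZagierPeriods.Theorems.HurwitzMicroSectorsNormalFormPrinciplePiBoxTransfer
import Summits.KontsevichZagierPeriods.KontsevichZagierPeriods.Theorems.HurwitzMicroSectorsNormalFormPrincipleVariants2239

/-! TTRL-lite variant V2346 of stmt-KontsevichZagierPeriods-3869

Variant V2346 = `stub_boxRigidity` (BoxRigidity: two box-rational representations — domain the open
unit box, integrand `p/q` over `ℚ` — with equal values are KZ-equivalent) under the JOINT small-case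
move `bound_nat:m≤6; bound_nat:m'≤2` (hypotheses in the order `m ≤ 6 → m' ≤ 2`). Verdict of the attempt
seat: **open** — this file is the exact-strength certificate, not a proof of the variant. As for every
joint bound (`boxRigidityLe_iff_boxVanishing`, file `…Variants2239`: `m ≤ j, m' ≤ k` is BoxVanishing in
the single dimension `max j k`), V2346 is EQUIVALENT to **BoxVanishing in dimension `6`** — every
box-rational representation on `(0,1)⁶` of value `0` is a Kontsevich–Zagier relation, i.e. Conjecture 1
for box-rational periods of dimension `6` (`stub_boxRigidity_var2346_iff_boxVanishing_six`: `⇒` compare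
with the zero representation on the `0`-box; `⇐` pad both sides to the `6`-box by unit intervals,
`pad_le`, subtract on the common box, `sub_same`, value `0` by soundness), equivalently to BoxRigidity
with BOTH dimensions `≤ 6` (`stub_boxRigidity_var2346_iff_boxRigidityLe_six`: the bound `m' ≤ 2` is idle
next to `m ≤ 6`). By monotonicity of BoxVanishing (`boxVanishing_mono`) V2346 gives BoxVanishing in
every dimension `≤ 6` (`boxVanishingLe_six_of_stub_boxRigidity_var2346`) and hence dominates every
jointly bounded sibling with `max j k ≤ 6` (`boxRigidityLe_of_stub_boxRigidity_var2346`,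
`boxRigidityFix_of_stub_boxRigidity_var2346`) — in particular the recorded-open V2338 (`= BoxVanishing(2)`:
Catalan's `G`, `π log 2`, `log² 2`, `Li₂`/Clausen values against `ℚ`), V2239/V2339/V2340/V2349/V2350
(`= BoxVanishing(3)`: e.g. "`ζ(3) ∈ ℚπ³` ⇒ the corresponding box-rational representations are
KZ-equivalent"), V2341 (`≤ 4`) and V2343 (`≤ 5`); so V2346 is open a fortiori, and
`KontsevichZagierPeriods → V2346` (`stub_boxRigidity_var2346_of_statement`), so a refutation of the
variant would refute Conjecture 1 for the tree's calculus (no invariant of `KZ.relations` beyond `eval`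
is known). The proved two-sided frontier stays `max j k ≤ 1` (`boxRigidityLe_of_max_le_one`, file
`…Variants2340`, Baker); dimension `2` is the first open one.
Source: M. Kontsevich, D. Zagier, *Periods* (2001), §1.2 Conjecture 1 and rules 1)–3).
Pure proof file, no definitions. -/

-- `Summit.<Summit>.<Problem>` is the tree's mandated summit-side namespace (CONVENTIONS §2); for this
-- single-conjunct summit the two coincide, so the duplicate is deliberate.
set_option linter.dupNamespace false

noncomputable section

namespace Summit.KontsevichZagierPeriods.KontsevichZagierPeriods.Theorems

open MeasureTheory Set
open Literature.NumberTheory.Transcendental Literature.NumberTheory.Transcendental.KZ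
open Summit.KontsevichZagierPeriods.KontsevichZagierPeriods.Theses.HurwitzMicroSectors
open Summit.KontsevichZagierPeriods.HurwitzMicroSectors.NormalFormPrinciple.PiBox

/-! ## The variant V2346: Conjecture 1 for box-rational periods of dimension 6 -/

/-- **V2346 ⟺ BoxVanishing in dimension `6`** (every box-rational representation on `(0,1)⁶` of value
`0` is a relation): `⇒` compare a box-rational representation on `(0,1)⁶` of value `0` (left slot,
`m = 6`) with the zero representation on the `0`-box (right slot, `m' = 0 ≤ 2`), itself a relation
(`boxVanishing_of_boxRigidityLe`); `⇐` pad both representations to `(0,1)⁶` and subtract on the common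
box, value `0` by soundness (`boxRigidityLe_of_boxVanishing`). The two hypotheses `m ≤ 6`, `m' ≤ 2` are
merely read in the variant's order. [cite: KontsevichZagier2001, §1.2 Conjecture 1] -/
theorem stub_boxRigidity_var2346_iff_boxVanishing_six :
    (∀ (m m' : ℕ) (N : IntegralRep m) (N' : IntegralRep m'), m ≤ 6 → m' ≤ 2 → N.domain = {x | ∀ i, x i ∈ Set.Ioo (0:ℝ) 1} → N.IsRational → N'.domain = {x | ∀ i, x i ∈ Set.Ioo (0:ℝ) 1} → N'.IsRational → N.value = N'.value → Equivalent N N') ↔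
    (∀ N : IntegralRep 6, N.domain = {x | ∀ i, x i ∈ Set.Ioo (0:ℝ) 1} → N.IsRational →
      N.value = 0 → of N ∈ relations) :=
  ⟨fun h => boxVanishing_of_boxRigidityLe (j := 6) (k := 2) (K := 6) le_rfl
      fun m m' N N' hm' hm => h m m' N N' hm hm',
    fun hvan m m' N N' hm hm' =>
      boxRigidityLe_of_boxVanishing (j := 6) (k := 2) (K := 6) le_rfl (by norm_num) hvan m m' N N' hm' hm⟩

/-- **V2346 ⇒ BoxVanishing in every dimension `≤ 6`** (monotonicity of BoxVanishing along padding,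
`boxVanishing_mono`): in particular the recorded-open BoxVanishing(`2`) (V2338), BoxVanishing(`3`)
(V2239, V2339, V2349, V2350), BoxVanishing(`≤ 4`) (V2341) and BoxVanishing(`≤ 5`) (V2343).
[cite: KontsevichZagier2001, §1.2 Conjecture 1] -/
theorem boxVanishingLe_six_of_stub_boxRigidity_var2346
    (h : ∀ (m m' : ℕ) (N : IntegralRep m) (N' : IntegralRep m'), m ≤ 6 → m' ≤ 2 → N.domain = {x | ∀ i, x i ∈ Set.Ioo (0:ℝ) 1} → N.IsRational → N'.domain = {x | ∀ i, x i ∈ Set.Ioo (0:ℝ) 1} → N'.IsRational → N.value = N'.value → Equivalent N N') :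
    ∀ (m : ℕ) (N : IntegralRep m), m ≤ 6 → N.domain = {x | ∀ i, x i ∈ Set.Ioo (0:ℝ) 1} →
      N.IsRational → N.value = 0 → of N ∈ relations :=
  fun _ N hm => boxVanishing_mono hm (stub_boxRigidity_var2346_iff_boxVanishing_six.1 h) N

/-- **BoxVanishing(`6`) ⇒ BoxRigidity(`m ≤ j`, `m' ≤ k`) whenever `max j k ≤ 6`** (pad both sides to
`(0,1)⁶`, subtract, soundness: `boxRigidityLe_of_boxVanishing` with `K = 6`).
[cite: KontsevichZagier2001, §1.2 Conjecture 1] -/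
theorem boxRigidityLe_of_boxVanishing_six (j k : ℕ) (hjk : max j k ≤ 6)
    (hvan : ∀ N : IntegralRep 6, N.domain = {x | ∀ i, x i ∈ Set.Ioo (0:ℝ) 1} → N.IsRational →
      N.value = 0 → of N ∈ relations) :
    ∀ (m m' : ℕ) (N : IntegralRep m) (N' : IntegralRep m'), m ≤ j → m' ≤ k →
      N.domain = {x | ∀ i, x i ∈ Set.Ioo (0:ℝ) 1} → N.IsRational →
      N'.domain = {x | ∀ i, x i ∈ Set.Ioo (0:ℝ) 1} → N'.IsRational →
      N.value = N'.value → Equivalent N N' :=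
  fun m m' N N' hm hm' =>
    boxRigidityLe_of_boxVanishing (le_of_max_le_left hjk) (le_of_max_le_right hjk) hvan m m' N N' hm' hm

/-- **V2346 ⟺ BoxRigidity with both dimensions `≤ 6`**: the bound `m' ≤ 2` is idle next to `m ≤ 6`
(the honest strength of the variant: Conjecture 1 for all pairs of rational integrands over `ℚ` on the
open unit boxes of dimension at most `6`). [cite: KontsevichZagier2001, §1.2 Conjecture 1] -/
theorem stub_boxRigidity_var2346_iff_boxRigidityLe_six :
    (∀ (m m' : ℕ) (N : IntegralRep m) (N' : IntegralRep m'), m ≤ 6 → m' ≤ 2 → N.domain = {x | ∀ i, x i ∈ Set.Ioo (0:ℝ) 1} → N.IsRational → N'.domain = {x | ∀ i, x i ∈ Set.Ioo (0:ℝ) 1} → N'.IsRational → N.value = N'.value → Equivalent N N') ↔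
    (∀ (m m' : ℕ) (N : IntegralRep m) (N' : IntegralRep m'), m ≤ 6 → m' ≤ 6 →
      N.domain = {x | ∀ i, x i ∈ Set.Ioo (0:ℝ) 1} → N.IsRational →
      N'.domain = {x | ∀ i, x i ∈ Set.Ioo (0:ℝ) 1} → N'.IsRational →
      N.value = N'.value → Equivalent N N') :=
  ⟨fun h => boxRigidityLe_of_boxVanishing_six 6 6 (by norm_num)
      (stub_boxRigidity_var2346_iff_boxVanishing_six.1 h),
    fun h m m' N N' hm hm' => h m m' N N' hm (hm'.trans (by norm_num))⟩

/-- **V2346 dominates every jointly bounded sibling with `max j k ≤ 6`**: V2346 ⇒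
`BoxRigidity(m ≤ j, m' ≤ k)` whenever `max j k ≤ 6` — in particular the recorded-open V2338 (`2, 2`),
V2239/V2350 (`3, 2` / `2, 3`), the `≤ 4` and `≤ 5` rungs (V2341, V2343); so V2346 is open a fortiori.
[cite: KontsevichZagier2001, §1.2 Conjecture 1] -/
theorem boxRigidityLe_of_stub_boxRigidity_var2346 (j k : ℕ) (hjk : max j k ≤ 6)
    (h : ∀ (m m' : ℕ) (N : IntegralRep m) (N' : IntegralRep m'), m ≤ 6 → m' ≤ 2 → N.domain = {x | ∀ i, x i ∈ Set.Ioo (0:ℝ) 1} → N.IsRational → N'.domain = {x | ∀ i, x i ∈ Set.Ioo (0:ℝ) 1} → N'.IsRational → N.value = N'.value → Equivalent N N') :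
    ∀ (m m' : ℕ) (N : IntegralRep m) (N' : IntegralRep m'), m ≤ j → m' ≤ k →
      N.domain = {x | ∀ i, x i ∈ Set.Ioo (0:ℝ) 1} → N.IsRational →
      N'.domain = {x | ∀ i, x i ∈ Set.Ioo (0:ℝ) 1} → N'.IsRational →
      N.value = N'.value → Equivalent N N' :=
  boxRigidityLe_of_boxVanishing_six j k hjk (stub_boxRigidity_var2346_iff_boxVanishing_six.1 h)

/-- **Any frozen right dimension `m' ≤ 6` is implied**: V2346 ⇒ the sibling with the right dimension
frozen to any `m' ≤ 6` and `m ≤ j ≤ 6` (e.g. V2339: `m' = 2`, `m ≤ 3`; V2343: `m' = 2`, `m ≤ 5`;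
V2349: `m' = 3`, `m ≤ 2`). [cite: KontsevichZagier2001, §1.2 Conjecture 1] -/
theorem boxRigidityFix_of_stub_boxRigidity_var2346 (j m' : ℕ) (hj : j ≤ 6) (hm' : m' ≤ 6)
    (h : ∀ (m m' : ℕ) (N : IntegralRep m) (N' : IntegralRep m'), m ≤ 6 → m' ≤ 2 → N.domain = {x | ∀ i, x i ∈ Set.Ioo (0:ℝ) 1} → N.IsRational → N'.domain = {x | ∀ i, x i ∈ Set.Ioo (0:ℝ) 1} → N'.IsRational → N.value = N'.value → Equivalent N N') :
    ∀ (m : ℕ) (N : IntegralRep m) (N' : IntegralRep m'), m ≤ j →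
      N.domain = {x | ∀ i, x i ∈ Set.Ioo (0:ℝ) 1} → N.IsRational →
      N'.domain = {x | ∀ i, x i ∈ Set.Ioo (0:ℝ) 1} → N'.IsRational →
      N.value = N'.value → Equivalent N N' :=
  fun m N N' hm => boxRigidityLe_of_stub_boxRigidity_var2346 6 6 (by norm_num) h m m' N N'
    (hm.trans hj) hm'

/-- **V2346 ⟺ the sibling V2239-shape with the bounds swapped to the other order and side**
(`m' ≤ 6 → m ≤ 2`, i.e. `bound_nat:m≤2; bound_nat:m'≤6` read as in `boxRigidityLe_iff_boxVanishing`):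
both are BoxVanishing(`6`) — which slot carries which bound is idle, `Equivalent` being symmetric.
[cite: KontsevichZagier2001, §1.2 Conjecture 1] -/
theorem stub_boxRigidity_var2346_iff_swap :
    (∀ (m m' : ℕ) (N : IntegralRep m) (N' : IntegralRep m'), m ≤ 6 → m' ≤ 2 → N.domain = {x | ∀ i, x i ∈ Set.Ioo (0:ℝ) 1} → N.IsRational → N'.domain = {x | ∀ i, x i ∈ Set.Ioo (0:ℝ) 1} → N'.IsRational → N.value = N'.value → Equivalent N N') ↔
    (∀ (m m' : ℕ) (N : IntegralRep m) (N' : IntegralRep m'), m' ≤ 6 → m ≤ 2 →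
      N.domain = {x | ∀ i, x i ∈ Set.Ioo (0:ℝ) 1} → N.IsRational →
      N'.domain = {x | ∀ i, x i ∈ Set.Ioo (0:ℝ) 1} → N'.IsRational →
      N.value = N'.value → Equivalent N N') :=
  ⟨fun h m m' N N' hm' hm => boxRigidityLe_of_stub_boxRigidity_var2346 2 6 (by norm_num) h m m' N N' hm hm',
    fun h => stub_boxRigidity_var2346_iff_boxVanishing_six.2
      ((boxRigidityLe_iff_boxVanishing 2 6).1 h)⟩

/-! ## The other side: the variant is implied by the Summit -/

/-- **The parent leaf ⇒ V2346** (the variant is a specialisation of `stub_boxRigidity`; the converse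
is not claimed — the parent is BoxVanishing in ALL dimensions). [cite: KontsevichZagier2001, §1.2 Conjecture 1] -/
theorem stub_boxRigidity_var2346_of_parent
    (h : ∀ (m m' : ℕ) (N : IntegralRep m) (N' : IntegralRep m'), N.domain = {x | ∀ i, x i ∈ Set.Ioo (0:ℝ) 1} → N.IsRational → N'.domain = {x | ∀ i, x i ∈ Set.Ioo (0:ℝ) 1} → N'.IsRational → N.value = N'.value → Equivalent N N') :
    ∀ (m m' : ℕ) (N : IntegralRep m) (N' : IntegralRep m'), m ≤ 6 → m' ≤ 2 → N.domain = {x | ∀ i, x i ∈ Set.Ioo (0:ℝ) 1} → N.IsRational → N'.domain = {x | ∀ i, x i ∈ Set.Ioo (0:ℝ) 1} → N'.IsRational → N.value = N'.value → Equivalent N N' :=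
  fun m m' N N' _ _ => h m m' N N'

/-- **`KontsevichZagierPeriods ⇒ V2346`**: the variant is a special case of Conjecture 1 for the
tree's calculus (`leaves_of_statement`) — a refutation of the variant would refute the Summit.
[cite: KontsevichZagier2001, §1.2 Conjecture 1] -/
theorem stub_boxRigidity_var2346_of_statement (h : _root_.KontsevichZagierPeriods) :
    ∀ (m m' : ℕ) (N : IntegralRep m) (N' : IntegralRep m'), m ≤ 6 → m' ≤ 2 → N.domain = {x | ∀ i, x i ∈ Set.Ioo (0:ℝ) 1} → N.IsRational → N'.domain = {x | ∀ i, x i ∈ Set.Ioo (0:ℝ) 1} → N'.IsRational → N.value = N'.value → Equivalent N N' :=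
  stub_boxRigidity_var2346_of_parent (leaves_of_statement h).1

end Summit.KontsevichZagierPeriods.KontsevichZagierPeriods.Theorems
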